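import Mathlib
import Summits.NavierStokesRegularity.NavierStokesRegularity.Theses.ClockStretchingLaw
import Summits.NavierStokesRegularity.NavierStokesRegularity.Theorems.ClockStretchingLawClockCeilingUniformVorticityFloor
import Literature.Analysis.FluidPDE.TypeIAncientMild
import Literature.Analysis.FluidPDE.TaoEnstrophyLocalisation
import Literature.Analysis.FluidPDE.DirectionDissipation
import HarnessLib

/-!
# Route ClockStretchingLaw, crux `ClockCeiling` (stmt-NavierStokesRegularity-10570) — the
# vorticity floor of a singular Type-I model is attained INSIDE the backward paraboloid

Localised upgrade of the class-uniform all-time vorticity floor `uniformVorticityFloor`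
(p159862): the floor `η(C)` of the gauge vorticity `(−t)‖ω(t, ·)‖` of a singular element of the
crux's Type-I class `𝒦_C` is attained at a point of the backward paraboloid
`{‖x‖ < R(C) √(−t)}` above the singular point, with an aperture `R(C)` depending on the class only.

**`localisedVorticityFloor`.** `∀ C ∃ η > 0 ∃ R > 0`: every `u ∈ 𝒦_C` singular at the space–time
origin has, at EVERY `t < 0`, a point `x` with `‖x‖ < R √(−t)` and `(−t)‖ω(t,x)‖ ≥ η`.

## Proof

At `t = −1` (`localisedVorticityFloor_at_neg_one`): otherwise there are singular `u_n ∈ 𝒦_C` with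
`‖ω_{u_n}(−1, x)‖ < 1/(n+1)` on the growing balls `‖x‖ < n + 1`; a subsequence converges with its
gradients (`exists_tendsto_of_typeI_seq_Ioo`) to an element `W ∈ A_C` that is singular at the
origin (`clockLaw_singular_of_limit`) and — every fixed `x` lying in the balls eventually — has the
irrotational slice `curl W(−1) ≡ 0`, against `exists_curl_ne_zero_of_singular`. All `t < 0` by the
zoom covariance of the class (`isTypeIAncientMild_zoom`, `limitSingular_energyLedger_zoom`,
`clockLaw_singular_zoom`, `curl_smul_stPull`), which maps the ball `‖y‖ < R` at time `−1` onto
`‖x‖ < R√(−t)` at time `t`.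

## References

* G. Koch, N. Nadirashvili, G. Seregin, V. Šverák, Acta Math. 203 (2009) 83–105, Lemma 3.1,
  Prop. 4.1, Remark 6.1 (arXiv:0709.3599). [KochNadirashviliSereginSverak2009]
* D. Albritton, T. Barker, ARMA 232 (2019), Lemma 2.2 and Prop. 2.3 (arXiv:1811.00502).
  [AlbrittonBarker2019]
-/

noncomputable section

-- the summit and its single sub-problem share the name (CONVENTIONS §1), as in every Theorems file
set_option linter.dupNamespace false

open MeasureTheory Filter Topology Set Metric Function
open scoped NNReal ENNReal

namespace Summit.NavierStokesRegularity.NavierStokesRegularity.Theorems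

open Literature.Analysis Literature.Analysis.FluidPDE
open Summit.NavierStokesRegularity.NavierStokesRegularity.Theorems.ClockLaw.Birth

/-- **Localised uniform vorticity floor at `t = −1`.** For every `C` there are `η > 0` and `R > 0`
such that every element of `𝒦_C` singular at the space–time origin has a point `x` with
`‖x‖ < R` and `‖ω(−1, x)‖ ≥ η`. Compactness along sequences of singular class elements
(`exists_tendsto_of_typeI_seq_Ioo`, `clockLaw_singular_of_limit`) on growing balls, against
`exists_curl_ne_zero_of_singular`. [cite: AlbrittonBarker2019, Lemma 2.2 and Prop. 2.3 (arXiv:1811.00502)] -/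
theorem localisedVorticityFloor_at_neg_one (C : ℝ) :
    ∃ η > 0, ∃ R > 0, ∀ u : ℝ → EuclideanSpace ℝ (Fin 3) → EuclideanSpace ℝ (Fin 3),
      IsTypeIAncientMild C u →
      (∀ (x₀ : EuclideanSpace ℝ (Fin 3)) (t₀ r : ℝ), t₀ ≤ 0 → 0 < r →
        (∀ t, t₀ - r ^ 2 < t → t < t₀ → r⁻¹ * ∫ x in Metric.ball x₀ r, ‖u t x‖ ^ 2 ≤ C) ∧
          r⁻¹ * ∫ t in Set.Ioo (t₀ - r ^ 2) t₀, ∫ x in Metric.ball x₀ r, ‖fderiv ℝ (u t) x‖ ^ 2 ≤ C) →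
      (∀ r > 0, ∀ M : ℝ, ∃ t ∈ Set.Ioo (-(r ^ 2)) (0 : ℝ),
        ∃ x ∈ Metric.ball (0 : EuclideanSpace ℝ (Fin 3)) r, M < ‖u t x‖) →
      ∃ x ∈ Metric.ball (0 : EuclideanSpace ℝ (Fin 3)) R, η ≤ ‖curl (u (-1)) x‖ := by
  by_contra h
  push Not at h
  -- singular elements with vorticity `< 1/(n+1)` on the ball of radius `n+1` at time `-1`
  have hseq : ∀ n : ℕ, ∃ u : ℝ → EuclideanSpace ℝ (Fin 3) → EuclideanSpace ℝ (Fin 3),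
      IsTypeIAncientMild C u ∧
      (∀ (x₀ : EuclideanSpace ℝ (Fin 3)) (t₀ r : ℝ), t₀ ≤ 0 → 0 < r →
        (∀ t, t₀ - r ^ 2 < t → t < t₀ → r⁻¹ * ∫ x in Metric.ball x₀ r, ‖u t x‖ ^ 2 ≤ C) ∧
          r⁻¹ * ∫ t in Set.Ioo (t₀ - r ^ 2) t₀, ∫ x in Metric.ball x₀ r, ‖fderiv ℝ (u t) x‖ ^ 2 ≤ C) ∧
      (∀ r > 0, ∀ M : ℝ, ∃ t ∈ Set.Ioo (-(r ^ 2)) (0 : ℝ),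
        ∃ x ∈ Metric.ball (0 : EuclideanSpace ℝ (Fin 3)) r, M < ‖u t x‖) ∧
      ∀ x ∈ Metric.ball (0 : EuclideanSpace ℝ (Fin 3)) ((n : ℝ) + 1),
        ‖curl (u (-1)) x‖ < 1 / ((n : ℝ) + 1) := fun n => by
    obtain ⟨u, hu, hE, hsing, hlt⟩ := h _ Nat.one_div_pos_of_nat ((n : ℝ) + 1) (by positivity)
    exact ⟨u, hu, hE, hsing, hlt⟩
  choose u hu hE hsing hlt using hseq
  -- compactness on the growing windows `(-(k+1), 0)`
  set A : ℕ → ℝ := fun k => -((k : ℝ) + 1) with hA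
  have hAt : Tendsto A atTop atBot :=
    tendsto_neg_atTop_atBot.comp (tendsto_natCast_atTop_atTop.atTop_add tendsto_const_nhds)
  have hcont : ∀ k, ContinuousOn (uncurry (u k)) (Ioo (A k) 0 ×ˢ univ) := fun k =>
    (hu k).continuousOn_uncurry.mono (prod_mono (fun t ht => ht.2) subset_rfl)
  have hdivw : ∀ k, ∀ t ∈ Ioo (A k) 0, IsWeaklyDivFree (u k t) := fun k t ht =>
    (hu k).isWeaklyDivFree ht.2
  have hmild : ∀ k, ∀ s t : ℝ, A k < s → s < t → t < 0 → ∀ x,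
      u k t x = UnboundedOperators.heatExtension (u k s) (t - s) x -
        oseenDuhamel 1 s (u k) (u k) t x :=
    fun k s t _ hst ht x => (hu k).mild_eq_heatExtension hst ht x
  have hI : ∀ k, ∀ t ∈ Ioo (A k) 0, ∀ x, ‖u k t x‖ ≤ C / Real.sqrt (-t) := fun k t ht x =>
    (hu k).norm_le ht.2 x
  obtain ⟨φ, hφ, W, hW, hpt, hptG, -, -⟩ :=
    exists_tendsto_of_typeI_seq_Ioo C hAt hcont hdivw hmild hI
  -- the limit is singular
  have hWsing := clockLaw_singular_of_limit (fun j => hu (φ j)) (fun j => hE (φ j))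
    (fun j => hsing (φ j)) hpt
  -- its vorticity at `-1` vanishes everywhere: every `x` lies in the balls eventually
  have hcurlW : ∀ x, curl (W (-1)) x = 0 := by
    intro x
    have hconv : Tendsto (fun j => curl (u (φ j) (-1)) x) atTop (𝓝 (curl (W (-1)) x)) := by
      simp only [curl_eq_curlCLM]
      exact (curlCLM.continuous.tendsto _).comp (hptG (-1) (by norm_num) x)
    have hb : Tendsto (fun j : ℕ => 1 / ((φ j : ℝ) + 1)) atTop (𝓝 0) :=
      (tendsto_one_div_add_atTop_nhds_zero_nat (𝕜 := ℝ)).comp hφ.tendsto_atTop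
    have hR : Tendsto (fun j : ℕ => (φ j : ℝ) + 1) atTop atTop :=
      (tendsto_natCast_atTop_atTop.comp hφ.tendsto_atTop).atTop_add tendsto_const_nhds
    have hev : ∀ᶠ j in atTop, ‖curl (u (φ j) (-1)) x‖ ≤ 1 / ((φ j : ℝ) + 1) := by
      filter_upwards [hR.eventually_gt_atTop ‖x‖] with j hj
      exact (hlt (φ j) x (by rwa [Metric.mem_ball, dist_zero_right])).le
    have hle : ‖curl (W (-1)) x‖ ≤ 0 := le_of_tendsto_of_tendsto hconv.norm hb hev
    exact norm_le_zero_iff.1 hle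
  obtain ⟨x, hx⟩ := exists_curl_ne_zero_of_singular hW hWsing (by norm_num : (-1 : ℝ) < 0)
  exact hx (hcurlW x)

/-- **The vorticity floor of a singular Type-I model is attained inside the backward paraboloid**
(portrait clause of crux `ClockCeiling` / the Type-I Liouville node). For every `C` there are
`η > 0` and `R > 0` such that every `u ∈ 𝒦_C` singular at the space–time origin has, at every
`t < 0`, a point `x` with `‖x‖ < R √(−t)` and `(−t)‖ω(t, x)‖ ≥ η`. The floor at `t = −1`
(`localisedVorticityFloor_at_neg_one`) transported by the zoom `u_c = c u(c² ·, c ·)`,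
`c = √(−t)` (`isTypeIAncientMild_zoom`, `limitSingular_energyLedger_zoom`, `clockLaw_singular_zoom`,
`curl_smul_stPull`). [cite: KochNadirashviliSereginSverak2009, §1 (1.2) and Lemma 3.1 (arXiv:0709.3599)] -/
theorem localisedVorticityFloor (C : ℝ) :
    ∃ η > 0, ∃ R > 0, ∀ u : ℝ → EuclideanSpace ℝ (Fin 3) → EuclideanSpace ℝ (Fin 3),
      IsTypeIAncientMild C u →
      (∀ (x₀ : EuclideanSpace ℝ (Fin 3)) (t₀ r : ℝ), t₀ ≤ 0 → 0 < r →
        (∀ t, t₀ - r ^ 2 < t → t < t₀ → r⁻¹ * ∫ x in Metric.ball x₀ r, ‖u t x‖ ^ 2 ≤ C) ∧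
          r⁻¹ * ∫ t in Set.Ioo (t₀ - r ^ 2) t₀, ∫ x in Metric.ball x₀ r, ‖fderiv ℝ (u t) x‖ ^ 2 ≤ C) →
      (∀ r > 0, ∀ M : ℝ, ∃ t ∈ Set.Ioo (-(r ^ 2)) (0 : ℝ),
        ∃ x ∈ Metric.ball (0 : EuclideanSpace ℝ (Fin 3)) r, M < ‖u t x‖) →
      ∀ t < 0, ∃ x ∈ Metric.ball (0 : EuclideanSpace ℝ (Fin 3)) (R * Real.sqrt (-t)),
        η ≤ (-t) * ‖curl (u t) x‖ := by
  obtain ⟨η, hη, R, hR, hfloor⟩ := localisedVorticityFloor_at_neg_one C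
  refine ⟨η, hη, R, hR, fun u hu hE hsing t ht => ?_⟩
  set c : ℝ := Real.sqrt (-t) with hcdef
  have hc : 0 < c := Real.sqrt_pos.2 (neg_pos.2 ht)
  have hc2 : c ^ 2 = -t := Real.sq_sqrt (neg_pos.2 ht).le
  have hv : IsTypeIAncientMild C (c • stPull (c ^ 2) c 0 0 u) := isTypeIAncientMild_zoom hu hc 0
  have hvE := limitSingular_energyLedger_zoom hu hE hc
  have hvsing := clockLaw_singular_zoom hsing hc
  obtain ⟨y, hy, hηy⟩ := hfloor _ hv hvE hvsing
  refine ⟨c • y, ?_, ?_⟩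
  · rw [Metric.mem_ball, dist_zero_right] at hy ⊢
    rw [norm_smul, Real.norm_of_nonneg hc.le, mul_comm]
    exact mul_lt_mul_of_pos_right hy hc
  · rw [curl_smul_stPull, zero_add, zero_add, norm_smul, Real.norm_of_nonneg (mul_pos hc hc).le,
      ← sq, hc2, show -t * (-1 : ℝ) = t by ring] at hηy
    exact hηy

/-- **Stub `stub_localisedVorticityFloor` (crux stmt-NavierStokesRegularity-10570, line `registered`,
portrait clause), in the vocabulary of the route's class `𝒦_C`** (the hypotheses of `ClockCeiling`
verbatim): `∀ C ∃ η > 0 ∃ R > 0`, every SINGULAR element of `𝒦_C` has, at every `t < 0`, a point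
`x` with `‖x‖ < R√(−t)` and `(−t)‖curl u(t, x)‖ ≥ η`. [cite: KochNadirashviliSereginSverak2009, Lemma 3.1 and Remark 6.1 (arXiv:0709.3599)] -/
theorem stub_localisedVorticityFloor :
    ∀ C : ℝ, ∃ η > 0, ∃ R > 0, ∀ u : ℝ → EuclideanSpace ℝ (Fin 3) → EuclideanSpace ℝ (Fin 3), (ContDiffOn ℝ (⊤ : ℕ∞) (Function.uncurry u) (Set.Iio 0 ×ˢ Set.univ) ∧ (∀ t < 0, Literature.Analysis.FluidPDE.VectorCalculus.IsDivFree (u t)) ∧ (∀ s t : ℝ, s < t → t < 0 → ∀ x, u t x = Literature.Analysis.FluidPDE.heatFlow (u s) (t - s) x - ∫ τ in Set.Ioo s t, ∫ y, ((-(inner ℝ (x - y) (u τ y) / (2 * (t - τ)) * Literature.Analysis.UnboundedOperators.heatKernel (t - τ) (x - y))) • u τ y + (∫ σ in Set.Ioi (t - τ), Literature.Analysis.UnboundedOperators.heatKernel σ (x - y) / (4 * σ ^ 2)) • (inner ℝ (x - y) (u τ y) • u τ y + inner ℝ (u τ y) (u τ y) • (x - y) + inner ℝ (x - y) (u τ y)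 • u τ y) - ((∫ σ in Set.Ioi (t - τ), Literature.Analysis.UnboundedOperators.heatKernel σ (x - y) / (8 * σ ^ 3)) * (inner ℝ (x - y) (u τ y) * inner ℝ (x - y) (u τ y))) • (x - y))) ∧ Literature.Analysis.FluidPDE.HasTypeITimeDecay C u ∧ (∀ (x₀ : EuclideanSpace ℝ (Fin 3)) (t₀ r : ℝ), t₀ ≤ 0 → 0 < r → (∀ t, t₀ - r ^ 2 < t → t < t₀ → r⁻¹ * ∫ x in Metric.ball x₀ r, ‖u t x‖ ^ 2 ≤ C) ∧ r⁻¹ * ∫ t in Set.Ioo (t₀ - r ^ 2) t₀, ∫ x in Metric.ball x₀ r, ‖fderiv ℝ (u t) x‖ ^ 2 ≤ C)) →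
      (∀ r > 0, ∀ M : ℝ, ∃ t ∈ Set.Ioo (-(r ^ 2)) (0 : ℝ), ∃ x ∈ Metric.ball (0 : EuclideanSpace ℝ (Fin 3)) r, M < ‖u t x‖) →
      ∀ t < 0, ∃ x ∈ Metric.ball (0 : EuclideanSpace ℝ (Fin 3)) (R * Real.sqrt (-t)),
        η ≤ (-t) * ‖Literature.Analysis.FluidPDE.curl (u t) x‖ := by
  intro C
  obtain ⟨η, hη, R, hR, hfloor⟩ := localisedVorticityFloor C
  refine ⟨η, hη, R, hR, fun u hu hsing t ht => ?_⟩
  have hTI : IsTypeIAncientMild C u :=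
    isTypeIAncientMild_iff.2 ⟨hu.1, hu.2.1, hu.2.2.1, hu.2.2.2.1⟩
  exact hfloor u hTI hu.2.2.2.2 hsing t ht

end Summit.NavierStokesRegularity.NavierStokesRegularity.Theorems

end
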